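import Literature.AlgebraicGeometry.HodgeTheory.LocalKernelConnected

/-!
# Route LinearSystemTorelli — crux `LocalTubeSpan`: local subgroups at one piece are conjugate

Helper file (`--supports stmt-HodgeConjecture-2490`, line `Sketch`, cycle 4 wave 4, stub
`stub_localSubgroup_conj_of_joinedIn`).  The crux ("local Schnell theorem", C. Schnell, *Primitive
cohomology and the tube mapping*, Math. Z. 268 (2010) = arXiv:0711.3927, §3, §7, §9) concerns the
LOCAL fundamental groups `G_{t₀} = im (π₁(B ∖ Δ, s') → π₁(P ∖ Δ, s))` of the discriminant
complement, which the tree models (`LocallyTrivialExtensionClasses`) as the subgroups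
`localSubgroup ι s N hs' γ ≤ π₁(S, s)`: the classes of loops at a view point `s'` with `ι s' ∈ N`
staying in `ι⁻¹ N`, transported to the base point `s` along a path `γ` from `s'` to `s`.  Such a
subgroup depends on the view point and on the path, but only up to conjugacy as long as the view
points are joined INSIDE `ι⁻¹ N` (A. Hatcher, *Algebraic Topology* (2002), §1.1 Prop. 1.5: the
change-of-base-point isomorphism `β_γ [ℓ] = [γ̄ · ℓ · γ]`, two of which differ by an inner
automorphism).  This is the remark "when `ι⁻¹ N` is path connected all these local subgroups are
conjugate, so one view point suffices" in the docstring of the tree's `localKernelOn`; the lead's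
skeleton uses it (with `H1resKer_conj_smul`, `localTubeSpan_ker_evalCoinvOn_conj_smul`) to evaluate
the typed crux at a single base point of the punctured ball.

* `localTubeSpan_localSubgroup_conj_of_joinedIn` — the registered stub: if `s₁`, `s₂` are joined
  in `ι⁻¹ N`, then for all paths `γ₁` (from `s₁` to `s`) and `γ₂` (from `s₂` to `s`) there is an
  `h ∈ π₁(S, s)` with `localSubgroup ι s N hs₁ γ₁ = h · (localSubgroup ι s N hs₂ γ₂) · h⁻¹`
  (`MulAut.conj h • _`).

The argument (Hatcher, loc. cit.): pick a path `δ` from `s₂` to `s₁` inside `ι⁻¹ N`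
(`JoinedIn.somePath`); transporting along `δ` carries the loops-in-`ι⁻¹ N` subgroup at `s₂` onto
the one at `s₁` (`δ̄ · ℓ · δ` stays inside, and conversely `δ · m · δ̄`), and the two transports
`β_{γ₁} ∘ β_δ` and `β_{γ₂}` from `π₁(S, s₂)` to `π₁(S, s)` differ by the inner automorphism of the
class of the loop `γ̄₂ · δ · γ₁` at `s`.  The tree's `LocalKernelConnected` provides exactly this,
with the explicit conjugator (`localSubgroup_eq_conj_smul`, on top of
`loopSubgroup_map_fundamentalGroupMulEquivOfPath` and `conj_fundamentalGroupMulEquivOfPath`); the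
present file packages it in the existential form consumed by the skeleton.  Pure bookkeeping over
Mathlib's fundamental groupoid (`FundamentalGroup.fundamentalGroupMulEquivOfPath`) and the tree's
definitions; no named facts.

References: [HatcherAT2002] A. Hatcher, Algebraic Topology (2002), §1.1 Prop. 1.5 (change of base
point is conjugation); [Schnell2010] C. Schnell, Primitive cohomology and the tube mapping,
Math. Z. 268 (2010), §9 (local fundamental groups of the discriminant complement).
-/

-- `Summit.HodgeConjecture.HodgeConjecture.Theorems` is the mandated namespace (single-conjunct summit:
-- Sub = Summit), which `linter.dupNamespace` flags on every declaration; the lakefile turns the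
-- linter off tree-wide (weak option), restated here so stand-alone elaboration is warning-free too.
set_option linter.dupNamespace false

noncomputable section

open CategoryTheory
open scoped Pointwise
open Literature.AlgebraicGeometry.HodgeTheory

namespace Summit.HodgeConjecture.HodgeConjecture.Theorems

universe u v

/-! ### Local subgroups seen from joined view points are conjugate -/

/-- **Local subgroups at a path-connected piece are conjugate (one view point suffices).** For a
continuous `ι : S → T`, a subset `N ⊆ T`, a base point `s` and two view points `s₁`, `s₂` with
`ι s₁, ι s₂ ∈ N` that are joined by a path inside `ι⁻¹ N`, the local subgroups
`localSubgroup ι s N hs₁ γ₁` and `localSubgroup ι s N hs₂ γ₂` of `π₁(S, s)` — for ANY paths `γ₁`,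
`γ₂` to the base point — are conjugate: with `δ` a path from `s₂` to `s₁` inside `ι⁻¹ N`, the
conjugator is the class of the loop `γ̄₂ · δ · γ₁` at `s` (change of base point is conjugation,
`β_{γ₁} ∘ β_δ = c_h ∘ β_{γ₂}`, and `β_δ` matches the loops staying in `ι⁻¹ N`).
[cite: HatcherAT2002, §1.1 Prop. 1.5] -/
theorem localTubeSpan_localSubgroup_conj_of_joinedIn {S : Type u} [TopologicalSpace S] {T : Type v}
    [TopologicalSpace T] (ι : C(S, T)) (s : S) (N : Set T) {s₁ s₂ : S} (hs₁ : ι s₁ ∈ N)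
    (hs₂ : ι s₂ ∈ N) (hjoin : JoinedIn (ι ⁻¹' N) s₁ s₂) (γ₁ : Path s₁ s) (γ₂ : Path s₂ s) :
    ∃ h : FundamentalGroup S s,
      localSubgroup ι s N hs₁ γ₁ = MulAut.conj h • localSubgroup ι s N hs₂ γ₂ :=
  ⟨FundamentalGroup.fromPath
      (Path.Homotopic.Quotient.mk (γ₂.symm.trans (hjoin.symm.somePath.trans γ₁))),
    localSubgroup_eq_conj_smul ι s hs₂ hs₁ hjoin.symm.somePath
      (Set.range_subset_iff.2 hjoin.symm.somePath_mem) γ₂ γ₁⟩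

end Summit.HodgeConjecture.HodgeConjecture.Theorems

end
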